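import Mathlib
import HarnessLib
import Summits.Ventures.LatticeQCDFlow.Exactness.SUNMultiStepLeapfrogFTHMCErgodic
import Summits.Ventures.LatticeQCDFlow.Exactness.SU2MaskedKickScheduleErgodic

/-!
# MULTI-STEP FT-HMC through whole `SU(2)` members — any schedule of masked kick layers, the engine's LO Wilson-flow member — is uniformly ergodic for short trajectories (row 9's `su2LeapfrogHMCN`, any `nstep`)

HONEST FRAMING: exact (Metropolis-corrected) sampling algorithms for lattice gauge theory;
figures of merit are autocorrelation/cost numbers at stated couplings and volumes; no
continuum-physics claim.

Venture `LatticeQCDFlow` (cell pub-lqcd), topic `Exactness`; FANOUT row 14 (`eng-flowhmc`, engine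
`latflow.fthmc`, family B; members = schedules of masked `SU(2)` kick layers with an accumulated log-det:
`maps.wilson_flow_lo`, `maps.residual_trained_scan`; the `SU(2)` rung at `nstep ≥ 2`).  NEW WORK of the
cell over the tree (`SUNMultiStepLeapfrogFTHMCErgodic.lean`: `su2LeapfrogFTHMCN_uniformlyErgodic` /
`_invariant_unique` — the reported `n`-step kernel through ANY pinched-Jacobian measurable equivalence;
GEN-10's `SU2MaskedKickScheduleErgodic.lean` (the `nstep = 1` twin, `foldr_logDet_mem_Icc`),
`SU2MaskedKickSchedule.exists_layers_su2MaskedKick`, `SU2MaskedKickErgodic.su2MaskedKickJacobian_mem_Icc`,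
`NCPLayerEquiv.hasJacobian_foldr_trans`, `SU2WilsonFlowLOSubstep` (`stapleJ_local`, `norm_stapleJ_le`,
`continuous_stapleJ`)); nothing is cited as a fact; no number.  GEN-10's schedule theorems listed
"multi-step trajectories inside row 9's kernel" as NOT CLAIMED; here they are, for short trajectories.

* **`su2MaskedKickSchedule_package`** — for layer specs `s : σ` (mask `P s`, step `εf s`, frozen
  measurable field `Jf s`) under the UNIFORM refusal bound `|εf s| ‖Jf s V e‖ ≤ κ₀`, `0 ≤ κ₀ < 1`, and ANY
  schedule: the certified layers (formulas VERBATIM), their densities positive, the running density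
  measurable and pinched in `[((1−κ₀)^(3|E|))^#layers, ((1+κ₀)^(3|E|))^#layers]`, the composite a
  measurable equivalence with `HasJacobian Haar^⊗ F J` — the one package every convergence theorem
  through the member consumes (the increment may be chosen AFTER the layers, e.g. the exact force
  through this very member);
* **`su2MaskedKickSchedule_fthmcN_uniformlyErgodic`** / **`_invariant_unique`** — hence, for EVERY
  `ε', κ' > 0`, `n ≥ 1`, measurable increment `|g| ≤ b'` that is `K_g`-Lipschitz in the matrix sup norm,
  measurable `|S| ≤ s'` with `nε', (2n+1)b', K_g ε'n² ≤ sunShortTrajThreshold pauliCoordι _`: the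
  reported `n`-step kernel converges to `su2GibbsLaw S` geometrically from EVERY initial law and
  `su2GibbsLaw S` is its unique invariant probability law;
* **`su2WilsonFlowLO_member_package`**, **`su2WilsonFlowLO_member_fthmcN_uniformlyErgodic`** — the
  instance: the engine's whole LO Wilson-flow member for ANY schedule `sched : List (Fin d × X)` (proper
  colouring, `2(d−1)|ε| < 1`, layers packaged VERBATIM as in `exists_layers_su2WilsonFlowLO`).

NOT CLAIMED: anything beyond the short-trajectory threshold; any usable constant; the bound and
Lipschitz constant of the engine's exact force through the member (the sequel
`SU2WilsonFlowLOExactForceRegular`); OMF words; learned residual members at `nstep ≥ 2` (same proof,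
not instantiated here); floating point; any number.
-/

noncomputable section

namespace Summit.Ventures.LatticeQCDFlow.Exactness

open Real Set MeasureTheory Measure InnerProductGeometry ProbabilityTheory ProbabilityTheory.Kernel
open Literature.MathematicalPhysics.QuantumFieldTheory
open scoped ENNReal Matrix Matrix.Norms.Operator

set_option backward.isDefEq.respectTransparency false

/-! ## §1 Any schedule of masked kick layers: the package, and multi-step FT-HMC through it -/

section Schedule

variable {d L : ℕ} [NeZero L] {σ : Type*} (P : σ → Edge d L → Prop) [∀ s, DecidablePred (P s)]

/-- **THE MEMBER PACKAGE.**  Under the uniform refusal bound `|εf s| ‖Jf s V e‖ ≤ κ₀ < 1`: certified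
layers with the schedule's formulas VERBATIM, positive densities, the running density measurable and
pinched, and `HasJacobian Haar^⊗ (F_n ∘ ⋯ ∘ F_1) J`. -/
theorem su2MaskedKickSchedule_package (εf : σ → ℝ)
    (Jf : σ → GaugeConfig d L (Matrix.specialUnitaryGroup (Fin 2) ℂ) → Edge d L → R4)
    (hJm : ∀ s e, P s e → Measurable fun V : GaugeConfig d L (Matrix.specialUnitaryGroup (Fin 2) ℂ) => Jf s V e)
    (hJloc : ∀ s (V W : GaugeConfig d L (Matrix.specialUnitaryGroup (Fin 2) ℂ)),
      (∀ j, ¬P s j → V j = W j) → ∀ e, P s e → Jf s V e = Jf s W e)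
    {κ₀ : ℝ} (hκ0 : 0 ≤ κ₀) (hκ₀ : κ₀ < 1)
    (hκ : ∀ s (V : GaugeConfig d L (Matrix.specialUnitaryGroup (Fin 2) ℂ)) (e : Edge d L), P s e → |εf s| * ‖Jf s V e‖ ≤ κ₀)
    (sched : List σ) :
    ∃ layers : List ((GaugeConfig d L (Matrix.specialUnitaryGroup (Fin 2) ℂ) ≃ᵐ GaugeConfig d L (Matrix.specialUnitaryGroup (Fin 2) ℂ)) × (GaugeConfig d L (Matrix.specialUnitaryGroup (Fin 2) ℂ) → ℝ)),
      layers.map (fun Ly => ((Ly.1 : GaugeConfig d L (Matrix.specialUnitaryGroup (Fin 2) ℂ) → GaugeConfig d L (Matrix.specialUnitaryGroup (Fin 2) ℂ)), Ly.2)) =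
        sched.map (fun s =>
          ((fun (V : GaugeConfig d L (Matrix.specialUnitaryGroup (Fin 2) ℂ)) (e : Edge d L) =>
            if P s e then gaussUnit (geodesicKick (εf s) (Jf s V e)
              (vecQuat ((V e : Matrix.specialUnitaryGroup (Fin 2) ℂ) : Matrix (Fin 2) (Fin 2) ℂ)))
            else V e),
           fun V : GaugeConfig d L (Matrix.specialUnitaryGroup (Fin 2) ℂ) => ∏ a : {e : Edge d L // P s e},
            (if Real.sin (angle (Jf s V a.1) (vecQuat ((V a.1 : Matrix.specialUnitaryGroup (Fin 2) ℂ) : Matrix (Fin 2) (Fin 2) ℂ))) = 0 then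
                (1 - εf s * ‖Jf s V a.1‖ * Real.cos (angle (Jf s V a.1) (vecQuat ((V a.1 : Matrix.specialUnitaryGroup (Fin 2) ℂ) : Matrix (Fin 2) (Fin 2) ℂ)))) ^ 3
              else kickJac (εf s * ‖Jf s V a.1‖) 2 (angle (Jf s V a.1) (vecQuat ((V a.1 : Matrix.specialUnitaryGroup (Fin 2) ℂ) : Matrix (Fin 2) (Fin 2) ℂ)))))) ∧
      (∀ Ly ∈ layers, ∀ V, 0 < Ly.2 V) ∧
      Measurable (layers.foldr (fun Ly K => fun v => Ly.2 v * K (Ly.1 v)) (fun _ => (1 : ℝ))) ∧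
      HasJacobian (Measure.pi fun _ : Edge d L => haarProbability (Matrix.specialUnitaryGroup (Fin 2) ℂ)) ⇑(layers.foldr (fun Ly (F : GaugeConfig d L (Matrix.specialUnitaryGroup (Fin 2) ℂ) ≃ᵐ GaugeConfig d L (Matrix.specialUnitaryGroup (Fin 2) ℂ)) => Ly.1.trans F) (MeasurableEquiv.refl (GaugeConfig d L (Matrix.specialUnitaryGroup (Fin 2) ℂ)))) (fun v => ENNReal.ofReal ((layers.foldr (fun Ly K => fun v => Ly.2 v * K (Ly.1 v)) (fun _ => (1 : ℝ))) v)) ∧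
      ∀ v, (layers.foldr (fun Ly K => fun v => Ly.2 v * K (Ly.1 v)) (fun _ => (1 : ℝ))) v ∈
        Icc (((1 - κ₀) ^ (3 * Fintype.card (Edge d L))) ^ layers.length) (((1 + κ₀) ^ (3 * Fintype.card (Edge d L))) ^ layers.length) := by
  have hlt : ∀ s (V : GaugeConfig d L (Matrix.specialUnitaryGroup (Fin 2) ℂ)) (e : Edge d L), P s e → |εf s| * ‖Jf s V e‖ < 1 :=
    fun s V e he => (hκ s V e he).trans_lt hκ₀
  obtain ⟨layers, hmap, hpos, hmeas, hjac⟩ := exists_layers_su2MaskedKick P εf Jf hJm hJloc hlt sched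
  refine ⟨layers, hmap, hpos, ?_⟩
  obtain ⟨-, hfmeas, hfjac⟩ := hasJacobian_foldr_trans layers hpos hmeas hjac
  refine ⟨hfmeas, hfjac, ?_⟩
  -- every packaged density is one of the schedule's booked densities, hence pinched
  have hpinch : ∀ Ly ∈ layers, ∀ v, Ly.2 v ∈
      Icc ((1 - κ₀) ^ (3 * Fintype.card (Edge d L))) ((1 + κ₀) ^ (3 * Fintype.card (Edge d L))) := by
    intro Ly hLy v
    have hmem : ((Ly.1 : GaugeConfig d L (Matrix.specialUnitaryGroup (Fin 2) ℂ) → GaugeConfig d L (Matrix.specialUnitaryGroup (Fin 2) ℂ)), Ly.2) ∈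
        sched.map (fun s =>
          ((fun (V : GaugeConfig d L (Matrix.specialUnitaryGroup (Fin 2) ℂ)) (e : Edge d L) =>
            if P s e then gaussUnit (geodesicKick (εf s) (Jf s V e)
              (vecQuat ((V e : Matrix.specialUnitaryGroup (Fin 2) ℂ) : Matrix (Fin 2) (Fin 2) ℂ)))
            else V e),
           fun V : GaugeConfig d L (Matrix.specialUnitaryGroup (Fin 2) ℂ) => ∏ a : {e : Edge d L // P s e},
            (if Real.sin (angle (Jf s V a.1) (vecQuat ((V a.1 : Matrix.specialUnitaryGroup (Fin 2) ℂ) : Matrix (Fin 2) (Fin 2) ℂ))) = 0 then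
                (1 - εf s * ‖Jf s V a.1‖ * Real.cos (angle (Jf s V a.1) (vecQuat ((V a.1 : Matrix.specialUnitaryGroup (Fin 2) ℂ) : Matrix (Fin 2) (Fin 2) ℂ)))) ^ 3
              else kickJac (εf s * ‖Jf s V a.1‖) 2 (angle (Jf s V a.1) (vecQuat ((V a.1 : Matrix.specialUnitaryGroup (Fin 2) ℂ) : Matrix (Fin 2) (Fin 2) ℂ)))))) := by
      rw [← hmap]
      exact List.mem_map.mpr ⟨Ly, hLy, rfl⟩
    obtain ⟨s, -, hs⟩ := List.mem_map.mp hmem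
    have hJ2 : Ly.2 = fun V : GaugeConfig d L (Matrix.specialUnitaryGroup (Fin 2) ℂ) => ∏ a : {e : Edge d L // P s e},
            (if Real.sin (angle (Jf s V a.1) (vecQuat ((V a.1 : Matrix.specialUnitaryGroup (Fin 2) ℂ) : Matrix (Fin 2) (Fin 2) ℂ))) = 0 then
                (1 - εf s * ‖Jf s V a.1‖ * Real.cos (angle (Jf s V a.1) (vecQuat ((V a.1 : Matrix.specialUnitaryGroup (Fin 2) ℂ) : Matrix (Fin 2) (Fin 2) ℂ)))) ^ 3
              else kickJac (εf s * ‖Jf s V a.1‖) 2 (angle (Jf s V a.1) (vecQuat ((V a.1 : Matrix.specialUnitaryGroup (Fin 2) ℂ) : Matrix (Fin 2) (Fin 2) ℂ)))) := (Prod.mk.inj hs).2.symm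
    have h := su2MaskedKickJacobian_mem_Icc (P s) (Jf s) (ε := εf s) hκ₀.le (hκ s) v
    rw [hJ2]
    have hn : Fintype.card {e : Edge d L // P s e} ≤ Fintype.card (Edge d L) := Fintype.card_subtype_le _
    refine ⟨le_trans ?_ h.1, h.2.trans ?_⟩
    · exact pow_le_pow_of_le_one (by linarith) (by linarith) (by omega)
    · exact pow_le_pow_right₀ (by linarith) (by omega)
  exact fun v => foldr_logDet_mem_Icc layers (pow_nonneg (by linarith) _) hpinch v

/-- **MULTI-STEP FT-HMC (row 9's `su2LeapfrogHMCN`, any `nstep`) through a whole schedule of masked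
`SU(2)` kick layers is uniformly ergodic for short trajectories** — the increment `g`, the action `S`
and the trajectory parameters are chosen AFTER the layers. -/
theorem su2MaskedKickSchedule_fthmcN_uniformlyErgodic (εf : σ → ℝ)
    (Jf : σ → GaugeConfig d L (Matrix.specialUnitaryGroup (Fin 2) ℂ) → Edge d L → R4)
    (hJm : ∀ s e, P s e → Measurable fun V : GaugeConfig d L (Matrix.specialUnitaryGroup (Fin 2) ℂ) => Jf s V e)
    (hJloc : ∀ s (V W : GaugeConfig d L (Matrix.specialUnitaryGroup (Fin 2) ℂ)),
      (∀ j, ¬P s j → V j = W j) → ∀ e, P s e → Jf s V e = Jf s W e)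
    {κ₀ : ℝ} (hκ0 : 0 ≤ κ₀) (hκ₀ : κ₀ < 1)
    (hκ : ∀ s (V : GaugeConfig d L (Matrix.specialUnitaryGroup (Fin 2) ℂ)) (e : Edge d L), P s e → |εf s| * ‖Jf s V e‖ ≤ κ₀)
    (sched : List σ) :
    ∃ layers : List ((GaugeConfig d L (Matrix.specialUnitaryGroup (Fin 2) ℂ) ≃ᵐ GaugeConfig d L (Matrix.specialUnitaryGroup (Fin 2) ℂ)) × (GaugeConfig d L (Matrix.specialUnitaryGroup (Fin 2) ℂ) → ℝ)),
      layers.map (fun Ly => ((Ly.1 : GaugeConfig d L (Matrix.specialUnitaryGroup (Fin 2) ℂ) → GaugeConfig d L (Matrix.specialUnitaryGroup (Fin 2) ℂ)), Ly.2)) =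
        sched.map (fun s =>
          ((fun (V : GaugeConfig d L (Matrix.specialUnitaryGroup (Fin 2) ℂ)) (e : Edge d L) =>
            if P s e then gaussUnit (geodesicKick (εf s) (Jf s V e)
              (vecQuat ((V e : Matrix.specialUnitaryGroup (Fin 2) ℂ) : Matrix (Fin 2) (Fin 2) ℂ)))
            else V e),
           fun V : GaugeConfig d L (Matrix.specialUnitaryGroup (Fin 2) ℂ) => ∏ a : {e : Edge d L // P s e},
            (if Real.sin (angle (Jf s V a.1) (vecQuat ((V a.1 : Matrix.specialUnitaryGroup (Fin 2) ℂ) : Matrix (Fin 2) (Fin 2) ℂ))) = 0 then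
                (1 - εf s * ‖Jf s V a.1‖ * Real.cos (angle (Jf s V a.1) (vecQuat ((V a.1 : Matrix.specialUnitaryGroup (Fin 2) ℂ) : Matrix (Fin 2) (Fin 2) ℂ)))) ^ 3
              else kickJac (εf s * ‖Jf s V a.1‖) 2 (angle (Jf s V a.1) (vecQuat ((V a.1 : Matrix.specialUnitaryGroup (Fin 2) ℂ) : Matrix (Fin 2) (Fin 2) ℂ)))))) ∧
      ∀ {ε' κ' : ℝ} (_hε' : 0 < ε') (_hκ' : 0 < κ') {n : ℕ} (_hn : 1 ≤ n)
        {g : GaugeConfig d L (Matrix.specialUnitaryGroup (Fin 2) ℂ) → Edge d L → EuclideanSpace ℝ (Fin 3)} (hg : Measurable g) {b' : ℝ} (_hb0 : 0 ≤ b')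
        (_hb : ∀ u l, ‖g u l‖ ≤ b') {Kg : ℝ} (_hK0 : 0 ≤ Kg)
        (_hK : ∀ U U', ‖g U - g U'‖ ≤ Kg * ‖coeConfig U - coeConfig U'‖)
        {S : GaugeConfig d L (Matrix.specialUnitaryGroup (Fin 2) ℂ) → ℝ} (_hS : Measurable S) {s' : ℝ} (_hs : ∀ u, |S u| ≤ s')
        (_h1 : n * ε' ≤ sunShortTrajThreshold pauliCoordι pauliCoordι_injective)
        (_h2 : (2 * n + 1) * b' ≤ sunShortTrajThreshold pauliCoordι pauliCoordι_injective)
        (_h3 : Kg * ε' * (n : ℝ) ^ 2 ≤ sunShortTrajThreshold pauliCoordι pauliCoordι_injective),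
        ∃ k : ℕ, ∃ δ : ℝ, 0 < δ ∧ δ ≤ 1 ∧ ∀ (μ₀ : Measure (GaugeConfig d L (Matrix.specialUnitaryGroup (Fin 2) ℂ))) [IsProbabilityMeasure μ₀] (t : ℕ) (A : Set (GaugeConfig d L (Matrix.specialUnitaryGroup (Fin 2) ℂ))),
          |((fun m : Measure (GaugeConfig d L (Matrix.specialUnitaryGroup (Fin 2) ℂ)) =>
                m.bind (conjKernel (su2LeapfrogHMCN ε' κ' hg (fun V => S ((layers.foldr (fun Ly (F : GaugeConfig d L (Matrix.specialUnitaryGroup (Fin 2) ℂ) ≃ᵐ GaugeConfig d L (Matrix.specialUnitaryGroup (Fin 2) ℂ)) => Ly.1.trans F) (MeasurableEquiv.refl (GaugeConfig d L (Matrix.specialUnitaryGroup (Fin 2) ℂ)))) V) - Real.log ((layers.foldr (fun Ly K => fun v => Ly.2 v * K (Ly.1 v)) (fun _ => (1 : ℝ))) V)) n) (layers.foldr (fun Ly (F : GaugeConfig d L (Matrix.specialUnitaryGroup (Fin 2) ℂ) ≃ᵐ GaugeConfig d L (Matrix.specialUnitaryGroup (Fin 2) ℂ)) => Ly.1.trans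 F) (MeasurableEquiv.refl (GaugeConfig d L (Matrix.specialUnitaryGroup (Fin 2) ℂ))))))^[t] μ₀).real A
              - (su2GibbsLaw S).real A| ≤ (1 - δ) ^ (t / (k + 1)) := by
  obtain ⟨layers, hmap, hpos, hfmeas, hfjac, hfold⟩ :=
    su2MaskedKickSchedule_package P εf Jf hJm hJloc hκ0 hκ₀ hκ sched
  refine ⟨layers, hmap, ?_⟩
  intro ε' κ' hε' hκ' n hn g hg b' hb0 hb Kg hK0 hK S hS s' hs h1 h2 h3
  exact su2LeapfrogFTHMCN_uniformlyErgodic hε' hκ' hn hg hb0 hb hK0 hK hS hs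
    (pow_pos (pow_pos (by linarith) _) _) (fun v => (hfold v).1) (fun v => (hfold v).2) hfmeas hfjac h1 h2 h3

/-- **… and `su2GibbsLaw S` is the UNIQUE invariant probability law** of that reported `n`-step kernel
(same hypotheses, chosen after the layers). -/
theorem su2MaskedKickSchedule_fthmcN_invariant_unique (εf : σ → ℝ)
    (Jf : σ → GaugeConfig d L (Matrix.specialUnitaryGroup (Fin 2) ℂ) → Edge d L → R4)
    (hJm : ∀ s e, P s e → Measurable fun V : GaugeConfig d L (Matrix.specialUnitaryGroup (Fin 2) ℂ) => Jf s V e)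
    (hJloc : ∀ s (V W : GaugeConfig d L (Matrix.specialUnitaryGroup (Fin 2) ℂ)),
      (∀ j, ¬P s j → V j = W j) → ∀ e, P s e → Jf s V e = Jf s W e)
    {κ₀ : ℝ} (hκ0 : 0 ≤ κ₀) (hκ₀ : κ₀ < 1)
    (hκ : ∀ s (V : GaugeConfig d L (Matrix.specialUnitaryGroup (Fin 2) ℂ)) (e : Edge d L), P s e → |εf s| * ‖Jf s V e‖ ≤ κ₀)
    (sched : List σ) :
    ∃ layers : List ((GaugeConfig d L (Matrix.specialUnitaryGroup (Fin 2) ℂ) ≃ᵐ GaugeConfig d L (Matrix.specialUnitaryGroup (Fin 2) ℂ)) × (GaugeConfig d L (Matrix.specialUnitaryGroup (Fin 2) ℂ) → ℝ)),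
      layers.map (fun Ly => ((Ly.1 : GaugeConfig d L (Matrix.specialUnitaryGroup (Fin 2) ℂ) → GaugeConfig d L (Matrix.specialUnitaryGroup (Fin 2) ℂ)), Ly.2)) =
        sched.map (fun s =>
          ((fun (V : GaugeConfig d L (Matrix.specialUnitaryGroup (Fin 2) ℂ)) (e : Edge d L) =>
            if P s e then gaussUnit (geodesicKick (εf s) (Jf s V e)
              (vecQuat ((V e : Matrix.specialUnitaryGroup (Fin 2) ℂ) : Matrix (Fin 2) (Fin 2) ℂ)))
            else V e),
           fun V : GaugeConfig d L (Matrix.specialUnitaryGroup (Fin 2) ℂ) => ∏ a : {e : Edge d L // P s e},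
            (if Real.sin (angle (Jf s V a.1) (vecQuat ((V a.1 : Matrix.specialUnitaryGroup (Fin 2) ℂ) : Matrix (Fin 2) (Fin 2) ℂ))) = 0 then
                (1 - εf s * ‖Jf s V a.1‖ * Real.cos (angle (Jf s V a.1) (vecQuat ((V a.1 : Matrix.specialUnitaryGroup (Fin 2) ℂ) : Matrix (Fin 2) (Fin 2) ℂ)))) ^ 3
              else kickJac (εf s * ‖Jf s V a.1‖) 2 (angle (Jf s V a.1) (vecQuat ((V a.1 : Matrix.specialUnitaryGroup (Fin 2) ℂ) : Matrix (Fin 2) (Fin 2) ℂ)))))) ∧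
      ∀ {ε' κ' : ℝ} (_hε' : 0 < ε') (_hκ' : 0 < κ') {n : ℕ} (_hn : 1 ≤ n)
        {g : GaugeConfig d L (Matrix.specialUnitaryGroup (Fin 2) ℂ) → Edge d L → EuclideanSpace ℝ (Fin 3)} (hg : Measurable g) {b' : ℝ} (_hb0 : 0 ≤ b')
        (_hb : ∀ u l, ‖g u l‖ ≤ b') {Kg : ℝ} (_hK0 : 0 ≤ Kg)
        (_hK : ∀ U U', ‖g U - g U'‖ ≤ Kg * ‖coeConfig U - coeConfig U'‖)
        {S : GaugeConfig d L (Matrix.specialUnitaryGroup (Fin 2) ℂ) → ℝ} (_hS : Measurable S) {s' : ℝ} (_hs : ∀ u, |S u| ≤ s')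
        (_h1 : n * ε' ≤ sunShortTrajThreshold pauliCoordι pauliCoordι_injective)
        (_h2 : (2 * n + 1) * b' ≤ sunShortTrajThreshold pauliCoordι pauliCoordι_injective)
        (_h3 : Kg * ε' * (n : ℝ) ^ 2 ≤ sunShortTrajThreshold pauliCoordι pauliCoordι_injective),
        ∀ (π' : Measure (GaugeConfig d L (Matrix.specialUnitaryGroup (Fin 2) ℂ))) [IsProbabilityMeasure π'],
          Invariant (conjKernel (su2LeapfrogHMCN ε' κ' hg (fun V => S ((layers.foldr (fun Ly (F : GaugeConfig d L (Matrix.specialUnitaryGroup (Fin 2) ℂ) ≃ᵐ GaugeConfig d L (Matrix.specialUnitaryGroup (Fin 2) ℂ)) => Ly.1.trans F) (MeasurableEquiv.refl (GaugeConfig d L (Matrix.specialUnitaryGroup (Fin 2) ℂ)))) V) - Real.log ((layers.foldr (fun Ly K => fun v => Ly.2 v * K (Ly.1 v)) (fun _ => (1 : ℝ))) V)) n) (layers.foldr (fun Ly (F : GaugeConfig d L (Matrix.specialUnitaryGroup (Fin 2) ℂ) ≃ᵐ GaugeConfig d L (Matrix.specialUnitaryGroup (Fin 2) ℂ)) =>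 Ly.1.trans F) (MeasurableEquiv.refl (GaugeConfig d L (Matrix.specialUnitaryGroup (Fin 2) ℂ))))) π' → π' = su2GibbsLaw S := by
  obtain ⟨layers, hmap, hpos, hfmeas, hfjac, hfold⟩ :=
    su2MaskedKickSchedule_package P εf Jf hJm hJloc hκ0 hκ₀ hκ sched
  refine ⟨layers, hmap, ?_⟩
  intro ε' κ' hε' hκ' n hn g hg b' hb0 hb Kg hK0 hK S hS s' hs h1 h2 h3 π' _ hπ'
  exact su2LeapfrogFTHMCN_invariant_unique hε' hκ' hn hg hb0 hb hK0 hK hS hs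
    (pow_pos (pow_pos (by linarith) _) _) (fun v => (hfold v).1) (fun v => (hfold v).2) hfmeas hfjac h1 h2 h3 hπ'

end Schedule

/-! ## §2 The engine's LO Wilson-flow member (any schedule) -/

section LO

variable {d L : ℕ} {X : Type*} [DecidableEq X] (χ : Site d L → X) [NeZero L]

/-- **THE LO MEMBER PACKAGE**: proper colouring `χ`, `2(d−1)|ε| < 1`, ANY schedule
`sched : List (Fin d × X)`; layers packaged VERBATIM as in `exists_layers_su2WilsonFlowLO`, positive
densities, measurable pinched running density, `HasJacobian Haar^⊗ F J`. -/
theorem su2WilsonFlowLO_member_package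
    (hχ : ∀ (x : Site d L) (i : Fin d), χ (x.shift i) ≠ χ x) {ε : ℝ}
    (hε : |ε| * (2 * ((d - 1 : ℕ) : ℝ)) < 1) (sched : List (Fin d × X)) :
    ∃ layers : List ((GaugeConfig d L (Matrix.specialUnitaryGroup (Fin 2) ℂ) ≃ᵐ GaugeConfig d L (Matrix.specialUnitaryGroup (Fin 2) ℂ)) × (GaugeConfig d L (Matrix.specialUnitaryGroup (Fin 2) ℂ) → ℝ)),
      layers.map (fun Ly => ((Ly.1 : GaugeConfig d L (Matrix.specialUnitaryGroup (Fin 2) ℂ) → GaugeConfig d L (Matrix.specialUnitaryGroup (Fin 2) ℂ)), Ly.2)) =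
        sched.map (fun s =>
        ((fun (V : GaugeConfig d L (Matrix.specialUnitaryGroup (Fin 2) ℂ)) (e : Edge d L) =>
        if e.2 = s.1 ∧ χ e.1 = s.2 then
          gaussUnit (geodesicKick ε (∑ ν ∈ Finset.univ.erase e.2,
            (vecQuat (((V (Site.shift e.1 e.2, ν) * (V (Site.shift e.1 ν, e.2))⁻¹ * (V (e.1, ν))⁻¹)⁻¹ : (Matrix.specialUnitaryGroup (Fin 2) ℂ)) : Matrix (Fin 2) (Fin 2) ℂ) +
              vecQuat ((((V (Site.shift (e.1 - Pi.single ν 1) e.2, ν))⁻¹ * (V (e.1 - Pi.single ν 1, e.2))⁻¹ *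
                V (e.1 - Pi.single ν 1, ν))⁻¹ : (Matrix.specialUnitaryGroup (Fin 2) ℂ)) : Matrix (Fin 2) (Fin 2) ℂ)))
            (vecQuat ((V e : (Matrix.specialUnitaryGroup (Fin 2) ℂ)) : Matrix (Fin 2) (Fin 2) ℂ)))
        else V e),
         fun V : GaugeConfig d L (Matrix.specialUnitaryGroup (Fin 2) ℂ) => ∏ a : {e : Edge d L // e.2 = s.1 ∧ χ e.1 = s.2},
          (if Real.sin (angle (∑ ν ∈ Finset.univ.erase a.1.2,
            (vecQuat (((V (Site.shift a.1.1 a.1.2, ν) * (V (Site.shift a.1.1 ν, a.1.2))⁻¹ * (V (a.1.1, ν))⁻¹)⁻¹ : (Matrix.specialUnitaryGroup (Fin 2) ℂ)) : Matrix (Fin 2) (Fin 2) ℂ) +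
              vecQuat ((((V (Site.shift (a.1.1 - Pi.single ν 1) a.1.2, ν))⁻¹ * (V (a.1.1 - Pi.single ν 1, a.1.2))⁻¹ *
                V (a.1.1 - Pi.single ν 1, ν))⁻¹ : (Matrix.specialUnitaryGroup (Fin 2) ℂ)) : Matrix (Fin 2) (Fin 2) ℂ))) (vecQuat ((V a.1 : (Matrix.specialUnitaryGroup (Fin 2) ℂ)) : Matrix (Fin 2) (Fin 2) ℂ))) = 0 then
            (1 - ε * ‖(∑ ν ∈ Finset.univ.erase a.1.2,
            (vecQuat (((V (Site.shift a.1.1 a.1.2, ν) * (V (Site.shift a.1.1 ν, a.1.2))⁻¹ * (V (a.1.1, ν))⁻¹)⁻¹ : (Matrix.specialUnitaryGroup (Fin 2) ℂ)) : Matrix (Fin 2) (Fin 2) ℂ) +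
              vecQuat ((((V (Site.shift (a.1.1 - Pi.single ν 1) a.1.2, ν))⁻¹ * (V (a.1.1 - Pi.single ν 1, a.1.2))⁻¹ *
                V (a.1.1 - Pi.single ν 1, ν))⁻¹ : (Matrix.specialUnitaryGroup (Fin 2) ℂ)) : Matrix (Fin 2) (Fin 2) ℂ)))‖ * Real.cos (angle (∑ ν ∈ Finset.univ.erase a.1.2,
            (vecQuat (((V (Site.shift a.1.1 a.1.2, ν) * (V (Site.shift a.1.1 ν, a.1.2))⁻¹ * (V (a.1.1, ν))⁻¹)⁻¹ : (Matrix.specialUnitaryGroup (Fin 2) ℂ)) : Matrix (Fin 2) (Fin 2) ℂ) +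
              vecQuat ((((V (Site.shift (a.1.1 - Pi.single ν 1) a.1.2, ν))⁻¹ * (V (a.1.1 - Pi.single ν 1, a.1.2))⁻¹ *
                V (a.1.1 - Pi.single ν 1, ν))⁻¹ : (Matrix.specialUnitaryGroup (Fin 2) ℂ)) : Matrix (Fin 2) (Fin 2) ℂ))) (vecQuat ((V a.1 : (Matrix.specialUnitaryGroup (Fin 2) ℂ)) : Matrix (Fin 2) (Fin 2) ℂ)))) ^ 3
          else kickJac (ε * ‖(∑ ν ∈ Finset.univ.erase a.1.2,
            (vecQuat (((V (Site.shift a.1.1 a.1.2, ν) * (V (Site.shift a.1.1 ν, a.1.2))⁻¹ * (V (a.1.1, ν))⁻¹)⁻¹ : (Matrix.specialUnitaryGroup (Fin 2) ℂ)) : Matrix (Fin 2) (Fin 2) ℂ) +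
              vecQuat ((((V (Site.shift (a.1.1 - Pi.single ν 1) a.1.2, ν))⁻¹ * (V (a.1.1 - Pi.single ν 1, a.1.2))⁻¹ *
                V (a.1.1 - Pi.single ν 1, ν))⁻¹ : (Matrix.specialUnitaryGroup (Fin 2) ℂ)) : Matrix (Fin 2) (Fin 2) ℂ)))‖) 2 (angle (∑ ν ∈ Finset.univ.erase a.1.2,
            (vecQuat (((V (Site.shift a.1.1 a.1.2, ν) * (V (Site.shift a.1.1 ν, a.1.2))⁻¹ * (V (a.1.1, ν))⁻¹)⁻¹ : (Matrix.specialUnitaryGroup (Fin 2) ℂ)) : Matrix (Fin 2) (Fin 2) ℂ) +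
              vecQuat ((((V (Site.shift (a.1.1 - Pi.single ν 1) a.1.2, ν))⁻¹ * (V (a.1.1 - Pi.single ν 1, a.1.2))⁻¹ *
                V (a.1.1 - Pi.single ν 1, ν))⁻¹ : (Matrix.specialUnitaryGroup (Fin 2) ℂ)) : Matrix (Fin 2) (Fin 2) ℂ))) (vecQuat ((V a.1 : (Matrix.specialUnitaryGroup (Fin 2) ℂ)) : Matrix (Fin 2) (Fin 2) ℂ)))))) ∧
      (∀ Ly ∈ layers, ∀ V, 0 < Ly.2 V) ∧
      Measurable (layers.foldr (fun Ly K => fun v => Ly.2 v * K (Ly.1 v)) (fun _ => (1 : ℝ))) ∧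
      HasJacobian (Measure.pi fun _ : Edge d L => haarProbability (Matrix.specialUnitaryGroup (Fin 2) ℂ)) ⇑(layers.foldr (fun Ly (F : GaugeConfig d L (Matrix.specialUnitaryGroup (Fin 2) ℂ) ≃ᵐ GaugeConfig d L (Matrix.specialUnitaryGroup (Fin 2) ℂ)) => Ly.1.trans F) (MeasurableEquiv.refl (GaugeConfig d L (Matrix.specialUnitaryGroup (Fin 2) ℂ)))) (fun v => ENNReal.ofReal ((layers.foldr (fun Ly K => fun v => Ly.2 v * K (Ly.1 v)) (fun _ => (1 : ℝ))) v)) ∧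
      ∀ v, (layers.foldr (fun Ly K => fun v => Ly.2 v * K (Ly.1 v)) (fun _ => (1 : ℝ))) v ∈
        Icc (((1 - |ε| * (2 * ((d - 1 : ℕ) : ℝ))) ^ (3 * Fintype.card (Edge d L))) ^ layers.length)
          (((1 + |ε| * (2 * ((d - 1 : ℕ) : ℝ))) ^ (3 * Fintype.card (Edge d L))) ^ layers.length) := by
  have h := su2MaskedKickSchedule_package (fun (s : Fin d × X) (e : Edge d L) => e.2 = s.1 ∧ χ e.1 = s.2)
    (fun _ => ε) (fun _ => fun (V : GaugeConfig d L (Matrix.specialUnitaryGroup (Fin 2) ℂ)) (e : Edge d L) => ∑ ν ∈ Finset.univ.erase e.2,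
        (vecQuat (((V (Site.shift e.1 e.2, ν) * (V (Site.shift e.1 ν, e.2))⁻¹ * (V (e.1, ν))⁻¹)⁻¹ : Matrix.specialUnitaryGroup (Fin 2) ℂ) : Matrix (Fin 2) (Fin 2) ℂ) +
          vecQuat ((((V (Site.shift (e.1 - Pi.single ν 1) e.2, ν))⁻¹ * (V (e.1 - Pi.single ν 1, e.2))⁻¹ * V (e.1 - Pi.single ν 1, ν))⁻¹ : Matrix.specialUnitaryGroup (Fin 2) ℂ) : Matrix (Fin 2) (Fin 2) ℂ)))
    (fun _ e _ => (continuous_stapleJ e).measurable)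
    (fun _ V W hVW e he => stapleJ_local χ hχ he hVW)
    (mul_nonneg (abs_nonneg ε) (by positivity)) hε
    (fun _ V e _ => mul_le_mul_of_nonneg_left (norm_stapleJ_le V e) (abs_nonneg ε))
    sched
  beta_reduce at h
  exact h

/-- **MULTI-STEP FT-HMC through the engine's whole `SU(2)` LO Wilson-flow member — ANY schedule — is
uniformly ergodic for short trajectories**, the increment / action / trajectory chosen after the
layers: for every `ε', κ' > 0`, `n ≥ 1`, measurable `|g| ≤ b'` `K_g`-Lipschitz in the matrix sup norm,
measurable `|S| ≤ s'`, `nε', (2n+1)b', K_g ε'n² ≤ sunShortTrajThreshold pauliCoordι _`. -/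
theorem su2WilsonFlowLO_member_fthmcN_uniformlyErgodic
    (hχ : ∀ (x : Site d L) (i : Fin d), χ (x.shift i) ≠ χ x) {ε : ℝ}
    (hε : |ε| * (2 * ((d - 1 : ℕ) : ℝ)) < 1) (sched : List (Fin d × X)) :
    ∃ layers : List ((GaugeConfig d L (Matrix.specialUnitaryGroup (Fin 2) ℂ) ≃ᵐ GaugeConfig d L (Matrix.specialUnitaryGroup (Fin 2) ℂ)) × (GaugeConfig d L (Matrix.specialUnitaryGroup (Fin 2) ℂ) → ℝ)),
      layers.map (fun Ly => ((Ly.1 : GaugeConfig d L (Matrix.specialUnitaryGroup (Fin 2) ℂ) → GaugeConfig d L (Matrix.specialUnitaryGroup (Fin 2) ℂ)), Ly.2)) =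
        sched.map (fun s =>
        ((fun (V : GaugeConfig d L (Matrix.specialUnitaryGroup (Fin 2) ℂ)) (e : Edge d L) =>
        if e.2 = s.1 ∧ χ e.1 = s.2 then
          gaussUnit (geodesicKick ε (∑ ν ∈ Finset.univ.erase e.2,
            (vecQuat (((V (Site.shift e.1 e.2, ν) * (V (Site.shift e.1 ν, e.2))⁻¹ * (V (e.1, ν))⁻¹)⁻¹ : (Matrix.specialUnitaryGroup (Fin 2) ℂ)) : Matrix (Fin 2) (Fin 2) ℂ) +
              vecQuat ((((V (Site.shift (e.1 - Pi.single ν 1) e.2, ν))⁻¹ * (V (e.1 - Pi.single ν 1, e.2))⁻¹ *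
                V (e.1 - Pi.single ν 1, ν))⁻¹ : (Matrix.specialUnitaryGroup (Fin 2) ℂ)) : Matrix (Fin 2) (Fin 2) ℂ)))
            (vecQuat ((V e : (Matrix.specialUnitaryGroup (Fin 2) ℂ)) : Matrix (Fin 2) (Fin 2) ℂ)))
        else V e),
         fun V : GaugeConfig d L (Matrix.specialUnitaryGroup (Fin 2) ℂ) => ∏ a : {e : Edge d L // e.2 = s.1 ∧ χ e.1 = s.2},
          (if Real.sin (angle (∑ ν ∈ Finset.univ.erase a.1.2,
            (vecQuat (((V (Site.shift a.1.1 a.1.2, ν) * (V (Site.shift a.1.1 ν, a.1.2))⁻¹ * (V (a.1.1, ν))⁻¹)⁻¹ : (Matrix.specialUnitaryGroup (Fin 2) ℂ)) : Matrix (Fin 2) (Fin 2) ℂ) +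
              vecQuat ((((V (Site.shift (a.1.1 - Pi.single ν 1) a.1.2, ν))⁻¹ * (V (a.1.1 - Pi.single ν 1, a.1.2))⁻¹ *
                V (a.1.1 - Pi.single ν 1, ν))⁻¹ : (Matrix.specialUnitaryGroup (Fin 2) ℂ)) : Matrix (Fin 2) (Fin 2) ℂ))) (vecQuat ((V a.1 : (Matrix.specialUnitaryGroup (Fin 2) ℂ)) : Matrix (Fin 2) (Fin 2) ℂ))) = 0 then
            (1 - ε * ‖(∑ ν ∈ Finset.univ.erase a.1.2,
            (vecQuat (((V (Site.shift a.1.1 a.1.2, ν) * (V (Site.shift a.1.1 ν, a.1.2))⁻¹ * (V (a.1.1, ν))⁻¹)⁻¹ : (Matrix.specialUnitaryGroup (Fin 2) ℂ)) : Matrix (Fin 2) (Fin 2) ℂ) +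
              vecQuat ((((V (Site.shift (a.1.1 - Pi.single ν 1) a.1.2, ν))⁻¹ * (V (a.1.1 - Pi.single ν 1, a.1.2))⁻¹ *
                V (a.1.1 - Pi.single ν 1, ν))⁻¹ : (Matrix.specialUnitaryGroup (Fin 2) ℂ)) : Matrix (Fin 2) (Fin 2) ℂ)))‖ * Real.cos (angle (∑ ν ∈ Finset.univ.erase a.1.2,
            (vecQuat (((V (Site.shift a.1.1 a.1.2, ν) * (V (Site.shift a.1.1 ν, a.1.2))⁻¹ * (V (a.1.1, ν))⁻¹)⁻¹ : (Matrix.specialUnitaryGroup (Fin 2) ℂ)) : Matrix (Fin 2) (Fin 2) ℂ) +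
              vecQuat ((((V (Site.shift (a.1.1 - Pi.single ν 1) a.1.2, ν))⁻¹ * (V (a.1.1 - Pi.single ν 1, a.1.2))⁻¹ *
                V (a.1.1 - Pi.single ν 1, ν))⁻¹ : (Matrix.specialUnitaryGroup (Fin 2) ℂ)) : Matrix (Fin 2) (Fin 2) ℂ))) (vecQuat ((V a.1 : (Matrix.specialUnitaryGroup (Fin 2) ℂ)) : Matrix (Fin 2) (Fin 2) ℂ)))) ^ 3
          else kickJac (ε * ‖(∑ ν ∈ Finset.univ.erase a.1.2,
            (vecQuat (((V (Site.shift a.1.1 a.1.2, ν) * (V (Site.shift a.1.1 ν, a.1.2))⁻¹ * (V (a.1.1, ν))⁻¹)⁻¹ : (Matrix.specialUnitaryGroup (Fin 2) ℂ)) : Matrix (Fin 2) (Fin 2) ℂ) +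
              vecQuat ((((V (Site.shift (a.1.1 - Pi.single ν 1) a.1.2, ν))⁻¹ * (V (a.1.1 - Pi.single ν 1, a.1.2))⁻¹ *
                V (a.1.1 - Pi.single ν 1, ν))⁻¹ : (Matrix.specialUnitaryGroup (Fin 2) ℂ)) : Matrix (Fin 2) (Fin 2) ℂ)))‖) 2 (angle (∑ ν ∈ Finset.univ.erase a.1.2,
            (vecQuat (((V (Site.shift a.1.1 a.1.2, ν) * (V (Site.shift a.1.1 ν, a.1.2))⁻¹ * (V (a.1.1, ν))⁻¹)⁻¹ : (Matrix.specialUnitaryGroup (Fin 2) ℂ)) : Matrix (Fin 2) (Fin 2) ℂ) +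
              vecQuat ((((V (Site.shift (a.1.1 - Pi.single ν 1) a.1.2, ν))⁻¹ * (V (a.1.1 - Pi.single ν 1, a.1.2))⁻¹ *
                V (a.1.1 - Pi.single ν 1, ν))⁻¹ : (Matrix.specialUnitaryGroup (Fin 2) ℂ)) : Matrix (Fin 2) (Fin 2) ℂ))) (vecQuat ((V a.1 : (Matrix.specialUnitaryGroup (Fin 2) ℂ)) : Matrix (Fin 2) (Fin 2) ℂ)))))) ∧
      ∀ {ε' κ' : ℝ} (_hε' : 0 < ε') (_hκ' : 0 < κ') {n : ℕ} (_hn : 1 ≤ n)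
        {g : GaugeConfig d L (Matrix.specialUnitaryGroup (Fin 2) ℂ) → Edge d L → EuclideanSpace ℝ (Fin 3)} (hg : Measurable g) {b' : ℝ} (_hb0 : 0 ≤ b')
        (_hb : ∀ u l, ‖g u l‖ ≤ b') {Kg : ℝ} (_hK0 : 0 ≤ Kg)
        (_hK : ∀ U U', ‖g U - g U'‖ ≤ Kg * ‖coeConfig U - coeConfig U'‖)
        {S : GaugeConfig d L (Matrix.specialUnitaryGroup (Fin 2) ℂ) → ℝ} (_hS : Measurable S) {s' : ℝ} (_hs : ∀ u, |S u| ≤ s')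
        (_h1 : n * ε' ≤ sunShortTrajThreshold pauliCoordι pauliCoordι_injective)
        (_h2 : (2 * n + 1) * b' ≤ sunShortTrajThreshold pauliCoordι pauliCoordι_injective)
        (_h3 : Kg * ε' * (n : ℝ) ^ 2 ≤ sunShortTrajThreshold pauliCoordι pauliCoordι_injective),
        ∃ k : ℕ, ∃ δ : ℝ, 0 < δ ∧ δ ≤ 1 ∧ ∀ (μ₀ : Measure (GaugeConfig d L (Matrix.specialUnitaryGroup (Fin 2) ℂ))) [IsProbabilityMeasure μ₀] (t : ℕ) (A : Set (GaugeConfig d L (Matrix.specialUnitaryGroup (Fin 2) ℂ))),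
          |((fun m : Measure (GaugeConfig d L (Matrix.specialUnitaryGroup (Fin 2) ℂ)) =>
                m.bind (conjKernel (su2LeapfrogHMCN ε' κ' hg (fun V => S ((layers.foldr (fun Ly (F : GaugeConfig d L (Matrix.specialUnitaryGroup (Fin 2) ℂ) ≃ᵐ GaugeConfig d L (Matrix.specialUnitaryGroup (Fin 2) ℂ)) => Ly.1.trans F) (MeasurableEquiv.refl (GaugeConfig d L (Matrix.specialUnitaryGroup (Fin 2) ℂ)))) V) - Real.log ((layers.foldr (fun Ly K => fun v => Ly.2 v * K (Ly.1 v)) (fun _ => (1 : ℝ))) V)) n) (layers.foldr (fun Ly (F : GaugeConfig d L (Matrix.specialUnitaryGroup (Fin 2) ℂ) ≃ᵐ GaugeConfig d L (Matrix.specialUnitaryGroup (Fin 2) ℂ)) => Ly.1.trans F) (MeasurableEquiv.refl (GaugeConfig d L (Matrix.specialUnitaryGroup (Fin 2) ℂ))))))^[t] μ₀).real A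
              - (su2GibbsLaw S).real A| ≤ (1 - δ) ^ (t / (k + 1)) := by
  obtain ⟨layers, hmap, hpos, hfmeas, hfjac, hfold⟩ := su2WilsonFlowLO_member_package χ hχ hε sched
  refine ⟨layers, hmap, ?_⟩
  intro ε' κ' hε' hκ' n hn g hg b' hb0 hb Kg hK0 hK S hS s' hs h1 h2 h3
  have hm : 0 < 1 - |ε| * (2 * ((d - 1 : ℕ) : ℝ)) := by linarith
  exact su2LeapfrogFTHMCN_uniformlyErgodic hε' hκ' hn hg hb0 hb hK0 hK hS hs
    (pow_pos (pow_pos hm _) _) (fun v => (hfold v).1) (fun v => (hfold v).2) hfmeas hfjac h1 h2 h3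

/-- **… and `su2GibbsLaw S` is the UNIQUE invariant probability law** of the LO member's reported
`n`-step kernel (same hypotheses). -/
theorem su2WilsonFlowLO_member_fthmcN_invariant_unique
    (hχ : ∀ (x : Site d L) (i : Fin d), χ (x.shift i) ≠ χ x) {ε : ℝ}
    (hε : |ε| * (2 * ((d - 1 : ℕ) : ℝ)) < 1) (sched : List (Fin d × X)) :
    ∃ layers : List ((GaugeConfig d L (Matrix.specialUnitaryGroup (Fin 2) ℂ) ≃ᵐ GaugeConfig d L (Matrix.specialUnitaryGroup (Fin 2) ℂ)) × (GaugeConfig d L (Matrix.specialUnitaryGroup (Fin 2) ℂ) → ℝ)),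
      layers.map (fun Ly => ((Ly.1 : GaugeConfig d L (Matrix.specialUnitaryGroup (Fin 2) ℂ) → GaugeConfig d L (Matrix.specialUnitaryGroup (Fin 2) ℂ)), Ly.2)) =
        sched.map (fun s =>
        ((fun (V : GaugeConfig d L (Matrix.specialUnitaryGroup (Fin 2) ℂ)) (e : Edge d L) =>
        if e.2 = s.1 ∧ χ e.1 = s.2 then
          gaussUnit (geodesicKick ε (∑ ν ∈ Finset.univ.erase e.2,
            (vecQuat (((V (Site.shift e.1 e.2, ν) * (V (Site.shift e.1 ν, e.2))⁻¹ * (V (e.1, ν))⁻¹)⁻¹ : (Matrix.specialUnitaryGroup (Fin 2) ℂ)) : Matrix (Fin 2) (Fin 2) ℂ) +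
              vecQuat ((((V (Site.shift (e.1 - Pi.single ν 1) e.2, ν))⁻¹ * (V (e.1 - Pi.single ν 1, e.2))⁻¹ *
                V (e.1 - Pi.single ν 1, ν))⁻¹ : (Matrix.specialUnitaryGroup (Fin 2) ℂ)) : Matrix (Fin 2) (Fin 2) ℂ)))
            (vecQuat ((V e : (Matrix.specialUnitaryGroup (Fin 2) ℂ)) : Matrix (Fin 2) (Fin 2) ℂ)))
        else V e),
         fun V : GaugeConfig d L (Matrix.specialUnitaryGroup (Fin 2) ℂ) => ∏ a : {e : Edge d L // e.2 = s.1 ∧ χ e.1 = s.2},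
          (if Real.sin (angle (∑ ν ∈ Finset.univ.erase a.1.2,
            (vecQuat (((V (Site.shift a.1.1 a.1.2, ν) * (V (Site.shift a.1.1 ν, a.1.2))⁻¹ * (V (a.1.1, ν))⁻¹)⁻¹ : (Matrix.specialUnitaryGroup (Fin 2) ℂ)) : Matrix (Fin 2) (Fin 2) ℂ) +
              vecQuat ((((V (Site.shift (a.1.1 - Pi.single ν 1) a.1.2, ν))⁻¹ * (V (a.1.1 - Pi.single ν 1, a.1.2))⁻¹ *
                V (a.1.1 - Pi.single ν 1, ν))⁻¹ : (Matrix.specialUnitaryGroup (Fin 2) ℂ)) : Matrix (Fin 2) (Fin 2) ℂ))) (vecQuat ((V a.1 : (Matrix.specialUnitaryGroup (Fin 2) ℂ)) : Matrix (Fin 2) (Fin 2) ℂ))) = 0 then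
            (1 - ε * ‖(∑ ν ∈ Finset.univ.erase a.1.2,
            (vecQuat (((V (Site.shift a.1.1 a.1.2, ν) * (V (Site.shift a.1.1 ν, a.1.2))⁻¹ * (V (a.1.1, ν))⁻¹)⁻¹ : (Matrix.specialUnitaryGroup (Fin 2) ℂ)) : Matrix (Fin 2) (Fin 2) ℂ) +
              vecQuat ((((V (Site.shift (a.1.1 - Pi.single ν 1) a.1.2, ν))⁻¹ * (V (a.1.1 - Pi.single ν 1, a.1.2))⁻¹ *
                V (a.1.1 - Pi.single ν 1, ν))⁻¹ : (Matrix.specialUnitaryGroup (Fin 2) ℂ)) : Matrix (Fin 2) (Fin 2) ℂ)))‖ * Real.cos (angle (∑ ν ∈ Finset.univ.erase a.1.2,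
            (vecQuat (((V (Site.shift a.1.1 a.1.2, ν) * (V (Site.shift a.1.1 ν, a.1.2))⁻¹ * (V (a.1.1, ν))⁻¹)⁻¹ : (Matrix.specialUnitaryGroup (Fin 2) ℂ)) : Matrix (Fin 2) (Fin 2) ℂ) +
              vecQuat ((((V (Site.shift (a.1.1 - Pi.single ν 1) a.1.2, ν))⁻¹ * (V (a.1.1 - Pi.single ν 1, a.1.2))⁻¹ *
                V (a.1.1 - Pi.single ν 1, ν))⁻¹ : (Matrix.specialUnitaryGroup (Fin 2) ℂ)) : Matrix (Fin 2) (Fin 2) ℂ))) (vecQuat ((V a.1 : (Matrix.specialUnitaryGroup (Fin 2) ℂ)) : Matrix (Fin 2) (Fin 2) ℂ)))) ^ 3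
          else kickJac (ε * ‖(∑ ν ∈ Finset.univ.erase a.1.2,
            (vecQuat (((V (Site.shift a.1.1 a.1.2, ν) * (V (Site.shift a.1.1 ν, a.1.2))⁻¹ * (V (a.1.1, ν))⁻¹)⁻¹ : (Matrix.specialUnitaryGroup (Fin 2) ℂ)) : Matrix (Fin 2) (Fin 2) ℂ) +
              vecQuat ((((V (Site.shift (a.1.1 - Pi.single ν 1) a.1.2, ν))⁻¹ * (V (a.1.1 - Pi.single ν 1, a.1.2))⁻¹ *
                V (a.1.1 - Pi.single ν 1, ν))⁻¹ : (Matrix.specialUnitaryGroup (Fin 2) ℂ)) : Matrix (Fin 2) (Fin 2) ℂ)))‖) 2 (angle (∑ ν ∈ Finset.univ.erase a.1.2,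
            (vecQuat (((V (Site.shift a.1.1 a.1.2, ν) * (V (Site.shift a.1.1 ν, a.1.2))⁻¹ * (V (a.1.1, ν))⁻¹)⁻¹ : (Matrix.specialUnitaryGroup (Fin 2) ℂ)) : Matrix (Fin 2) (Fin 2) ℂ) +
              vecQuat ((((V (Site.shift (a.1.1 - Pi.single ν 1) a.1.2, ν))⁻¹ * (V (a.1.1 - Pi.single ν 1, a.1.2))⁻¹ *
                V (a.1.1 - Pi.single ν 1, ν))⁻¹ : (Matrix.specialUnitaryGroup (Fin 2) ℂ)) : Matrix (Fin 2) (Fin 2) ℂ))) (vecQuat ((V a.1 : (Matrix.specialUnitaryGroup (Fin 2) ℂ)) : Matrix (Fin 2) (Fin 2) ℂ)))))) ∧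
      ∀ {ε' κ' : ℝ} (_hε' : 0 < ε') (_hκ' : 0 < κ') {n : ℕ} (_hn : 1 ≤ n)
        {g : GaugeConfig d L (Matrix.specialUnitaryGroup (Fin 2) ℂ) → Edge d L → EuclideanSpace ℝ (Fin 3)} (hg : Measurable g) {b' : ℝ} (_hb0 : 0 ≤ b')
        (_hb : ∀ u l, ‖g u l‖ ≤ b') {Kg : ℝ} (_hK0 : 0 ≤ Kg)
        (_hK : ∀ U U', ‖g U - g U'‖ ≤ Kg * ‖coeConfig U - coeConfig U'‖)
        {S : GaugeConfig d L (Matrix.specialUnitaryGroup (Fin 2) ℂ) → ℝ} (_hS : Measurable S) {s' : ℝ} (_hs : ∀ u, |S u| ≤ s')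
        (_h1 : n * ε' ≤ sunShortTrajThreshold pauliCoordι pauliCoordι_injective)
        (_h2 : (2 * n + 1) * b' ≤ sunShortTrajThreshold pauliCoordι pauliCoordι_injective)
        (_h3 : Kg * ε' * (n : ℝ) ^ 2 ≤ sunShortTrajThreshold pauliCoordι pauliCoordι_injective),
        ∀ (π' : Measure (GaugeConfig d L (Matrix.specialUnitaryGroup (Fin 2) ℂ))) [IsProbabilityMeasure π'],
          Invariant (conjKernel (su2LeapfrogHMCN ε' κ' hg (fun V => S ((layers.foldr (fun Ly (F : GaugeConfig d L (Matrix.specialUnitaryGroup (Fin 2) ℂ) ≃ᵐ GaugeConfig d L (Matrix.specialUnitaryGroup (Fin 2) ℂ)) => Ly.1.trans F) (MeasurableEquiv.refl (GaugeConfig d L (Matrix.specialUnitaryGroup (Fin 2) ℂ)))) V) - Real.log ((layers.foldr (fun Ly K => fun v => Ly.2 v * K (Ly.1 v)) (fun _ => (1 : ℝ))) V)) n) (layers.foldr (fun Ly (F : GaugeConfig d L (Matrix.specialUnitaryGroup (Fin 2) ℂ) ≃ᵐ GaugeConfig d L (Matrix.specialUnitaryGroup (Fin 2) ℂ)) =>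 Ly.1.trans F) (MeasurableEquiv.refl (GaugeConfig d L (Matrix.specialUnitaryGroup (Fin 2) ℂ))))) π' → π' = su2GibbsLaw S := by
  obtain ⟨layers, hmap, hpos, hfmeas, hfjac, hfold⟩ := su2WilsonFlowLO_member_package χ hχ hε sched
  refine ⟨layers, hmap, ?_⟩
  intro ε' κ' hε' hκ' n hn g hg b' hb0 hb Kg hK0 hK S hS s' hs h1 h2 h3 π' _ hπ'
  have hm : 0 < 1 - |ε| * (2 * ((d - 1 : ℕ) : ℝ)) := by linarith
  exact su2LeapfrogFTHMCN_invariant_unique hε' hκ' hn hg hb0 hb hK0 hK hS hs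
    (pow_pos (pow_pos hm _) _) (fun v => (hfold v).1) (fun v => (hfold v).2) hfmeas hfjac h1 h2 h3 hπ'

end LO

end Summit.Ventures.LatticeQCDFlow.Exactness
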